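/-
Copyright (c) 2026 the pub-hodgecm-mathlib formalisation cell (harness21).  Prover seat hodgecm-mathlib-LH4-p08 (g8), req620 Track A «(D-RAM) FOUR-FRAME» squad, helper lane
on h413 = stmt-HodgeConjecture-24833 (count-neutral).  STAGE-1b, row (2) cone road: (LAW-arith)-Unr, the type-U twin of LH4-p07 (g9)'s ★ p859957.  2026-09-04.
-/
import Summits.HodgeConjecture.HodgeConjecture.Theorems.F0P3cDyRamStageOneBDefs   -- ★ p859562 (dealer): `csOfRecord`, `klOfRecord`, `blOfRecord` (D-1b exponents); brings `mstarOfRecord`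
import Mathlib.Algebra.Ring.GeomSum
import HarnessLib

/-!
# Crux `H413`, line LH4 «(D-RAM) FOUR-FRAME» — STAGE-1b, row (2): (LAW-arith)-Unr «THE CLOSING ARITHMETIC OF THE LEVEL-PIECE CENSUS LAW, TYPE U»
# `(q − 1)·q^{ks}·V_U(m₁, jλ₁, C) = q^m·((q + 1)·q^{jλ∕2} − 2·q^{shiftR d + bs})` for the three pieces of record

Cell `hodgecm-mathlib` (D-0151), FLOOR 0, crux item H413 = `stmt-HodgeConjecture-24833`, route of record `HCCMUnconditional`; squad F0∕P3c∕LH4 (req618∕req620); helper lane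
`--supports stmt-HodgeConjecture-24833 --as helper` (count-neutral).  THEOREMS ONLY (no `def`, no instance, no notation, no `sorry`; default heartbeats); pure `ℚ`∕`ℕ` bookkeeping.

THE OBJECT.  ★ p860037 ∕ ★ p860069 (this seat) put the G-side census difference of a type-U level piece `lev_{a′,b′}` at the scaled tokens `(m₁, jλ₁) = (m − a′, jλ − a′)` with the
diagonal cutoff `C = m + jλ − b′` in the closed form `V_U(m₁, jλ₁, C)` — ★ T5s-v5's value `q^{m₁}(1 + (q+1)[jλ₁∕2]_q − 2[S]_q)` (even `a′`; `[⌊jλ₁∕2⌋ + d%2]_q`, `[d − 1 + d%2]_q` for odd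
`a′`) minus the two cut top bands (exactly one fires per token branch).  THIS FILE is the arithmetic that turns `V_U` into the two-literal law's right-hand side — the type-U twin of
LH4-p07 (g9)'s ★ p859957 `law_arith_*` (RamK):
* `law_arith_unr` — the abstract exponent identity `(x − 1)x^k(x^M(1 + (x+1)[A] − 2[B]) − (x+1)x^E[n]) = x^N((x+1)x^P − 2x^T)` from `n = 0 ∨ M + A = E + n` (the ball's top cancels
  the band's top, or there is no band), `k + M + A = N + P + n`, `k + M + B = N + T`;
* **`law_arith_unr_sq`** (`sq_{m*}` = lev(0, m*), also `lev_{ℓ₀,m*}` at even `d`; `a′ = 0`, even lane; `(ks, bs) = (cs, cs)`), **`law_arith_unr_levLo_odd`** (`lev_{ℓ₀,m*}`, odd `d`,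
  `a′ = 1`, odd lane; `(cs, cs)`), **`law_arith_unr_levHi_even`** (`lev_{ℓ₀+1,m*}`, even `d`, `a′ = 1`, odd lane; `(kl, bl)`), **`law_arith_unr_levHi_odd`** (odd `d`, `a′ = 2`, even
  lane; `(kl, bl)`): `(q − 1)·q^{ks}·V_U = q^m·((q + 1)·q^{jλ∕2} − 2·q^{(d − d%2) + bs})` on BOTH token branches (`m ≡ d ∧ m + d ≤ jλ` or `m = jλ − d + 1`; `jλ` even), from
  `C + m* = m + jλ` and the near-1 thresholds `m* ≤ m₁ + 2a′`, `m* + 2d ≤ jλ₁ + 2a′ + 2` by `omega` on the exponents — these ARE the dealer's D-1b letters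
  `(csOfRecord, csOfRecord)` ∕ `(klOfRecord, blOfRecord)` (★ p859562) on the type-(2) side of type U, «𝒜 = ρ».
With the unit's H-side count `(q − 1)·NV_U = (q + 1)q^{jλ∕2} − 2` (`NV_U = 1 + (q+1)[jλ∕2]_q`, ★ T5s type U) this is LH4-p07's `law_template` shape `2q^m(R − q^T)`, `R = (q+1)q^{jλ∕2}∕2`:
`q^{−m}·V_U = q^{−ks}·NV_U + 2(q^{−ks} − q^{shiftR d − ks + bs})∕(q − 1)` — the digits `cA∕2 = q^{−ks}`, `cB∕2 = 2(q^{−ks} − q^{shiftR d − ks + bs})∕(q − 1)` of ★ p859606's `hLaw`, as on RamK.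
EVIDENCE (python twin, `F0/P3c/LH4/LH4-p08/g8/lawfit_unr.v1` + `lawarith_unr.v1`): the law on the ★ v5 TABLES at q ∈ {2,3}, d ≤ 5, both branches, near-1 thresholds — EXACT for all
three pieces (1 510 cases, 0 bad); the closed-form identity of this file for q ≤ 5, d ≤ 8 — 8 524 cases, 0 bad.
HONEST LABEL.  Count-neutral arithmetic; no frame, no CM place, no law asserted; `HC_CM` is proved only modulo the 7 printed citations (2 remaining named inputs: hLiu418 =
`stmt-HodgeConjecture-24832`, h413 = `stmt-HodgeConjecture-24833`) until rung 0 closes.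

## References
* [Kottwitz1986BaseChangeUnits] R. E. Kottwitz, *Base change for unit elements of Hecke algebras*, Compositio Math. 60 (1986): §1 pp. 240–241 (the lattice-count form of the sides).
* [Rogawski1990] J. D. Rogawski, *Automorphic Representations of Unitary Groups in Three Variables*, Ann. of Math. Stud. 123 (1990): §4.9 Prop. 4.9.1 (b) p. 55 (the transfer identity
  whose constants these are).
* [Flicker1998UnitaryFL] Y. Z. Flicker, *Elementary proof of the fundamental lemma for a unitary group*, Canad. J. Math. 50 (1998): Prop. 7 p. 84 (the counting recursion).
-/

set_option autoImplicit false

namespace Summit.HodgeConjecture.HodgeConjecture.Cruxes.H413.F0P3cDyRamLevelsCensusLawArithUnr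

open Finset
open Summit.HodgeConjecture.HodgeConjecture.Cruxes.H413.F0P3cDyRamFourFramePieces (mstarOfRecord)
open Summit.HodgeConjecture.HodgeConjecture.Cruxes.H413.F0P3cDyRamStageOneBDefs (csOfRecord klOfRecord blOfRecord)

/-- **THE CLOSING ARITHMETIC, ABSTRACT EXPONENTS (type U shape).**  `(x − 1)·x^k·(x^M(1 + (x+1)[A]_x − 2[B]_x) − (x+1)x^E[n]_x) = x^N((x+1)x^P − 2x^T)` whenever the band is
empty or the ball's top cancels the band's top (`n = 0 ∨ M + A = E + n`), `k + M + A = N + P + n` and `k + M + B = N + T`.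
[cite: Rogawski1990, §4.9 Prop. 4.9.1 (b) p. 55] [cite: Kottwitz1986BaseChangeUnits, §1 pp. 240–241] -/
theorem law_arith_unr (x : ℚ) {k M A B E n N P T : ℕ}
    (h1 : n = 0 ∨ M + A = E + n) (h2 : k + (M + A) = N + P + n) (h3 : k + (M + B) = N + T) :
    (x - 1) * x ^ k * (x ^ M * ((1 + (x + 1) * ∑ i ∈ range A, x ^ i) - 2 * ∑ i ∈ range B, x ^ i) - (x + 1) * x ^ E * ∑ i ∈ range n, x ^ i) =
      x ^ N * ((x + 1) * x ^ P - 2 * x ^ T) := by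
  have gA : (∑ i ∈ range A, x ^ i) * (x - 1) = x ^ A - 1 := geom_sum_mul x A
  have gB : (∑ i ∈ range B, x ^ i) * (x - 1) = x ^ B - 1 := geom_sum_mul x B
  have gn : (∑ i ∈ range n, x ^ i) * (x - 1) = x ^ n - 1 := geom_sum_mul x n
  have e3 : x ^ k * (x ^ M * x ^ B) = x ^ N * x ^ T := by rw [← pow_add, ← pow_add, ← pow_add, h3]
  rcases h1 with hn | hE
  · subst hn
    have e2 : x ^ k * (x ^ M * x ^ A) = x ^ N * x ^ P := by rw [← pow_add, ← pow_add, ← pow_add, h2, add_zero]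
    rw [sum_range_zero, mul_zero, sub_zero]
    linear_combination (x ^ k * x ^ M * (x + 1)) * gA - (2 * x ^ k * x ^ M) * gB + (x + 1) * e2 - 2 * e3
  · have e1 : x ^ M * x ^ A = x ^ E * x ^ n := by rw [← pow_add, ← pow_add, hE]
    have e2 : x ^ k * x ^ E = x ^ N * x ^ P := by rw [← pow_add, ← pow_add, show k + E = N + P by omega]
    linear_combination (x ^ k * x ^ M * (x + 1)) * gA - (2 * x ^ k * x ^ M) * gB - ((x + 1) * x ^ k * x ^ E) * gn
      + ((x + 1) * x ^ k) * e1 + (x + 1) * e2 - 2 * e3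

/-- **CLOSING ARITHMETIC, `sq_{m*}` = lev(0, m*)** (also `lev_{ℓ₀,m*}` at even `d`): `a′ = 0`, even lane, `(ks, bs) = (cs, cs)`; both token branches. [cite: Rogawski1990, §4.9 Prop. 4.9.1 (b) p. 55] [cite: Flicker1998UnitaryFL, Prop. 7 p. 84] -/
theorem law_arith_unr_sq (q : ℕ) {d m jl m₁ jl₁ C : ℕ} (hd : 2 ≤ d)
    (hme : m₁ + 0 = m) (hjle : jl₁ + 0 = jl) (hjl : jl % 2 = 0)
    (hreal : (m % 2 = d % 2 ∧ m + d ≤ jl) ∨ m = jl - d + 1) (hdjl : d ≤ jl) (hm1 : 1 ≤ m₁)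
    (hCeq : C + mstarOfRecord d = m + jl) (hmD : mstarOfRecord d ≤ m₁ + 2 * 0)
    (hjlD : mstarOfRecord d + 2 * d ≤ jl₁ + 2 * 0 + 2) :
    ((q : ℚ) - 1) * (q : ℚ) ^ csOfRecord d *
      ((q : ℚ) ^ m₁ * ((1 + ((q : ℚ) + 1) * ∑ i ∈ range (jl₁ / 2), (q : ℚ) ^ i) - 2 * ∑ i ∈ range (d - d % 2), (q : ℚ) ^ i)
      - (if m₁ + d ≤ jl₁ ∧ (jl₁ - m₁ - d) % 2 = 0 then
          ((q : ℚ) + 1) * (q : ℚ) ^ (((C + m₁ - jl₁) / 2 + 1) + d + (jl₁ - m₁ - d) / 2 + m₁ / 2 - 1) *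
            ∑ i ∈ range (((2 * m₁ + 1 - d) / 2 + 1) - ((C + m₁ - jl₁) / 2 + 1)), (q : ℚ) ^ i
        else 0)
      - (if jl₁ + 1 = d + m₁ then
          ((q : ℚ) + 1) * (q : ℚ) ^ (((C + m₁ - jl₁) / 2 + 1) + d + m₁ - m₁ / 2 - 2) *
            ∑ i ∈ range (((2 * m₁ + 1 - d) / 2 + 1) - ((C + m₁ - jl₁) / 2 + 1)), (q : ℚ) ^ i
        else 0)) =
      (q : ℚ) ^ m * (((q : ℚ) + 1) * (q : ℚ) ^ (jl / 2) - 2 * (q : ℚ) ^ ((d - d % 2) + csOfRecord d)) := by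
  have hms : mstarOfRecord d = d % 2 + 2 * d - 1 := rfl
  have hcs : csOfRecord d = (d + 1) / 2 := rfl
  have hkl : klOfRecord d = max (d % 2 + 1) d - d / 2 + 1 := rfl
  have hbl : blOfRecord d = klOfRecord d - 2 := rfl
  rcases hreal with ⟨hpar, hmd⟩ | hmeq
  · rw [if_pos (show m₁ + d ≤ jl₁ ∧ (jl₁ - m₁ - d) % 2 = 0 by omega), if_neg (show ¬ (jl₁ + 1 = d + m₁) by omega), sub_zero]
    rcases Nat.mod_two_eq_zero_or_one d with hδ | hδ <;> exact law_arith_unr (q : ℚ) (by omega) (by omega) (by omega)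
  · rw [if_neg (show ¬ (m₁ + d ≤ jl₁ ∧ (jl₁ - m₁ - d) % 2 = 0) from fun h => by omega), if_pos (show jl₁ + 1 = d + m₁ by omega), sub_zero]
    rcases Nat.mod_two_eq_zero_or_one d with hδ | hδ <;> exact law_arith_unr (q : ℚ) (by omega) (by omega) (by omega)

/-- **CLOSING ARITHMETIC, `lev_{ℓ₀,m*}` at ODD `d`**: `a′ = 1`, odd lane at `(m₁, jλ₁) = (m − 1, jλ − 1)`, `(ks, bs) = (cs, cs)`. [cite: Rogawski1990, §4.9 Prop. 4.9.1 (b) p. 55] -/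
theorem law_arith_unr_levLo_odd (q : ℕ) {d m jl m₁ jl₁ C : ℕ} (hd : 2 ≤ d) (hdpar : d % 2 = 1)
    (hme : m₁ + 1 = m) (hjle : jl₁ + 1 = jl) (hjl : jl % 2 = 0)
    (hreal : (m % 2 = d % 2 ∧ m + d ≤ jl) ∨ m = jl - d + 1) (hdjl : d ≤ jl) (hm1 : 1 ≤ m₁)
    (hCeq : C + mstarOfRecord d = m + jl) (hmD : mstarOfRecord d ≤ m₁ + 2 * 1)
    (hjlD : mstarOfRecord d + 2 * d ≤ jl₁ + 2 * 1 + 2) :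
    ((q : ℚ) - 1) * (q : ℚ) ^ csOfRecord d *
      ((q : ℚ) ^ m₁ * ((1 + ((q : ℚ) + 1) * ∑ i ∈ range (jl₁ / 2 + d % 2), (q : ℚ) ^ i) - 2 * ∑ i ∈ range (d - 1 + d % 2), (q : ℚ) ^ i)
      - (if m₁ + d ≤ jl₁ ∧ (jl₁ - m₁ - d) % 2 = 0 then
          ((q : ℚ) + 1) * (q : ℚ) ^ (((C + m₁ - jl₁) / 2 + 1) + d + (jl₁ - m₁ - d) / 2 + m₁ / 2 - 1) *
            ∑ i ∈ range (((2 * m₁ + 1 - d) / 2 + 1) - ((C + m₁ - jl₁) / 2 + 1)), (q : ℚ) ^ i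
        else 0)
      - (if jl₁ + 1 = d + m₁ then
          ((q : ℚ) + 1) * (q : ℚ) ^ (((C + m₁ - jl₁) / 2 + 1) + d + m₁ - m₁ / 2 - 2) *
            ∑ i ∈ range (((2 * m₁ + 1 - d) / 2 + 1) - ((C + m₁ - jl₁) / 2 + 1)), (q : ℚ) ^ i
        else 0)) =
      (q : ℚ) ^ m * (((q : ℚ) + 1) * (q : ℚ) ^ (jl / 2) - 2 * (q : ℚ) ^ ((d - d % 2) + csOfRecord d)) := by
  have hms : mstarOfRecord d = d % 2 + 2 * d - 1 := rfl
  have hcs : csOfRecord d = (d + 1) / 2 := rfl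
  have hkl : klOfRecord d = max (d % 2 + 1) d - d / 2 + 1 := rfl
  have hbl : blOfRecord d = klOfRecord d - 2 := rfl
  rcases hreal with ⟨hpar, hmd⟩ | hmeq
  · rw [if_pos (show m₁ + d ≤ jl₁ ∧ (jl₁ - m₁ - d) % 2 = 0 by omega), if_neg (show ¬ (jl₁ + 1 = d + m₁) by omega), sub_zero]
    exact law_arith_unr (q : ℚ) (by omega) (by omega) (by omega)
  · rw [if_neg (show ¬ (m₁ + d ≤ jl₁ ∧ (jl₁ - m₁ - d) % 2 = 0) from fun h => by omega), if_pos (show jl₁ + 1 = d + m₁ by omega), sub_zero]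
    exact law_arith_unr (q : ℚ) (by omega) (by omega) (by omega)

/-- **CLOSING ARITHMETIC, `lev_{ℓ₀+1,m*}` at EVEN `d`**: `a′ = 1`, odd lane, `(ks, bs) = (kl, bl)` (at `d = 2` the band is empty). [cite: Rogawski1990, §4.9 Prop. 4.9.1 (b) p. 55] -/
theorem law_arith_unr_levHi_even (q : ℕ) {d m jl m₁ jl₁ C : ℕ} (hd : 2 ≤ d) (hdpar : d % 2 = 0)
    (hme : m₁ + 1 = m) (hjle : jl₁ + 1 = jl) (hjl : jl % 2 = 0)
    (hreal : (m % 2 = d % 2 ∧ m + d ≤ jl) ∨ m = jl - d + 1) (hdjl : d ≤ jl) (hm1 : 1 ≤ m₁)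
    (hCeq : C + mstarOfRecord d = m + jl) (hmD : mstarOfRecord d ≤ m₁ + 2 * 1)
    (hjlD : mstarOfRecord d + 2 * d ≤ jl₁ + 2 * 1 + 2) :
    ((q : ℚ) - 1) * (q : ℚ) ^ klOfRecord d *
      ((q : ℚ) ^ m₁ * ((1 + ((q : ℚ) + 1) * ∑ i ∈ range (jl₁ / 2 + d % 2), (q : ℚ) ^ i) - 2 * ∑ i ∈ range (d - 1 + d % 2), (q : ℚ) ^ i)
      - (if m₁ + d ≤ jl₁ ∧ (jl₁ - m₁ - d) % 2 = 0 then
          ((q : ℚ) + 1) * (q : ℚ) ^ (((C + m₁ - jl₁) / 2 + 1) + d + (jl₁ - m₁ - d) / 2 + m₁ / 2 - 1) *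
            ∑ i ∈ range (((2 * m₁ + 1 - d) / 2 + 1) - ((C + m₁ - jl₁) / 2 + 1)), (q : ℚ) ^ i
        else 0)
      - (if jl₁ + 1 = d + m₁ then
          ((q : ℚ) + 1) * (q : ℚ) ^ (((C + m₁ - jl₁) / 2 + 1) + d + m₁ - m₁ / 2 - 2) *
            ∑ i ∈ range (((2 * m₁ + 1 - d) / 2 + 1) - ((C + m₁ - jl₁) / 2 + 1)), (q : ℚ) ^ i
        else 0)) =
      (q : ℚ) ^ m * (((q : ℚ) + 1) * (q : ℚ) ^ (jl / 2) - 2 * (q : ℚ) ^ ((d - d % 2) + blOfRecord d)) := by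
  have hms : mstarOfRecord d = d % 2 + 2 * d - 1 := rfl
  have hcs : csOfRecord d = (d + 1) / 2 := rfl
  have hkl : klOfRecord d = max (d % 2 + 1) d - d / 2 + 1 := rfl
  have hbl : blOfRecord d = klOfRecord d - 2 := rfl
  rcases hreal with ⟨hpar, hmd⟩ | hmeq
  · rw [if_pos (show m₁ + d ≤ jl₁ ∧ (jl₁ - m₁ - d) % 2 = 0 by omega), if_neg (show ¬ (jl₁ + 1 = d + m₁) by omega), sub_zero]
    exact law_arith_unr (q : ℚ) (by omega) (by omega) (by omega)
  · rw [if_neg (show ¬ (m₁ + d ≤ jl₁ ∧ (jl₁ - m₁ - d) % 2 = 0) from fun h => by omega), if_pos (show jl₁ + 1 = d + m₁ by omega), sub_zero]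
    exact law_arith_unr (q : ℚ) (by omega) (by omega) (by omega)

set_option maxHeartbeats 400000 in
/-- **CLOSING ARITHMETIC, `lev_{ℓ₀+1,m*}` at ODD `d`**: `a′ = 2`, even lane at `(m − 2, jλ − 2)`, `(ks, bs) = (kl, bl)`. [cite: Rogawski1990, §4.9 Prop. 4.9.1 (b) p. 55] -/
theorem law_arith_unr_levHi_odd (q : ℕ) {d m jl m₁ jl₁ C : ℕ} (hd : 2 ≤ d) (hdpar : d % 2 = 1)
    (hme : m₁ + 2 = m) (hjle : jl₁ + 2 = jl) (hjl : jl % 2 = 0)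
    (hreal : (m % 2 = d % 2 ∧ m + d ≤ jl) ∨ m = jl - d + 1) (hdjl : d ≤ jl) (hm1 : 1 ≤ m₁)
    (hCeq : C + mstarOfRecord d = m + jl) (hmD : mstarOfRecord d ≤ m₁ + 2 * 2)
    (hjlD : mstarOfRecord d + 2 * d ≤ jl₁ + 2 * 2 + 2) :
    ((q : ℚ) - 1) * (q : ℚ) ^ klOfRecord d *
      ((q : ℚ) ^ m₁ * ((1 + ((q : ℚ) + 1) * ∑ i ∈ range (jl₁ / 2), (q : ℚ) ^ i) - 2 * ∑ i ∈ range (d - d % 2), (q : ℚ) ^ i)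
      - (if m₁ + d ≤ jl₁ ∧ (jl₁ - m₁ - d) % 2 = 0 then
          ((q : ℚ) + 1) * (q : ℚ) ^ (((C + m₁ - jl₁) / 2 + 1) + d + (jl₁ - m₁ - d) / 2 + m₁ / 2 - 1) *
            ∑ i ∈ range (((2 * m₁ + 1 - d) / 2 + 1) - ((C + m₁ - jl₁) / 2 + 1)), (q : ℚ) ^ i
        else 0)
      - (if jl₁ + 1 = d + m₁ then
          ((q : ℚ) + 1) * (q : ℚ) ^ (((C + m₁ - jl₁) / 2 + 1) + d + m₁ - m₁ / 2 - 2) *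
            ∑ i ∈ range (((2 * m₁ + 1 - d) / 2 + 1) - ((C + m₁ - jl₁) / 2 + 1)), (q : ℚ) ^ i
        else 0)) =
      (q : ℚ) ^ m * (((q : ℚ) + 1) * (q : ℚ) ^ (jl / 2) - 2 * (q : ℚ) ^ ((d - d % 2) + blOfRecord d)) := by
  have hms : mstarOfRecord d = d % 2 + 2 * d - 1 := rfl
  have hcs : csOfRecord d = (d + 1) / 2 := rfl
  have hkl : klOfRecord d = max (d % 2 + 1) d - d / 2 + 1 := rfl
  have hbl : blOfRecord d = klOfRecord d - 2 := rfl
  rcases hreal with ⟨hpar, hmd⟩ | hmeq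
  · rw [if_pos (show m₁ + d ≤ jl₁ ∧ (jl₁ - m₁ - d) % 2 = 0 by omega), if_neg (show ¬ (jl₁ + 1 = d + m₁) by omega), sub_zero]
    exact law_arith_unr (q : ℚ) (by omega) (by omega) (by omega)
  · rw [if_neg (show ¬ (m₁ + d ≤ jl₁ ∧ (jl₁ - m₁ - d) % 2 = 0) from fun h => by omega), if_pos (show jl₁ + 1 = d + m₁ by omega), sub_zero]
    exact law_arith_unr (q : ℚ) (by omega) (by omega) (by omega)

end Summit.HodgeConjecture.HodgeConjecture.Cruxes.H413.F0P3cDyRamLevelsCensusLawArithUnr
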